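import Summits.QuantumFields.YangMills.Theorems.VirialFluxGapTreeGaugeGibbsTransfer
import Summits.QuantumFields.YangMills.Theorems.VirialFluxGapRingHaarIBP
import HarnessLib

/-!
# Route `VirialFluxGap` (YangMills): w3 g58's virial ∕ IBP engine on the REDUCED product group `X_fix = SU(2)^{off-tree} × (slices 1…2L−1) × (seam)`
# (tree gauge of slice `0`) — pairing, virial mean inequality and floor-controlled error term for the reduced deficit

✓`EulerFieldReduction.periodicSoftness_of_eulerField` (w3 g58) reduces the deciding crux ⟨stmt-QuantumFields-24141⟩ to an Euler-type
coefficient field on the FULL ring space `Ω_L`, where the `3L³` gauge directions must carry weight `0` in the divergence budget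
`18L⁴ − 2c₁` (the radial profile alone has divergence `18L⁴ + 3L³`).  By ✓`TreeGaugeTransfer.gibbsMean_eq_fix` ∕ `measureReal_deficit_le_eq_fix`
the Gibbs mean and the volume floor live equally well on the reduced product group
`X_fix = (OffIdx L → SU2) × ((Fin (2L−1) → GaugeConfig 3 L SU2) × (Site 3 L → SU2))` with product Haar `μ_fix` and reduced deficit
`F_fix(w, r) = F₀(glue w ∷ r)` (slice `0` in comb gauge), whose only residual symmetry is the constant `SU(2)` and whose valley is the
explicit 6-parameter comb family (✓`RegularValley.ringDeficit_eq_zero_iff_comb`).  This file runs w3's generic engine ✓`HaarIBP` there: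

* §1 `measurableMul_fixSpace`, `isMulRightInvariant_fixMeasure`, `integrable_mul_exp_of_bound_fix`, `integral_exp_fix_pos`;
* §2 `fix_pairing`, `fix_virial_gibbsMean_le`, `fix_gibbsMean_error_le` (floor via the EXACT transfer of sublevel volumes), `fix_virial_mean_bound`;
* the reduction `periodicSoftness_of_eulerFieldFix` (w3's «EulerField» hypothesis verbatim on `X_fix` ⟹ `PeriodicSoftness`) is the companion
  route-cone file `VirialFluxGapPeriodicSoftnessOfEulerFieldFix`.

ROUTE-INDEPENDENT.  HONEST FRAMING: engine bookkeeping; the Euler field on `X_fix` is NOT constructed; ⟨24141⟩ stays OPEN; the Yang–Mills mass gap is NOT proved; no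
summit is proved by a line.  THEOREMS ONLY (0 `def`, 0 `sorry`), standard axioms.  Width seat `ym-line-sfw-p2-w2` g51 (cell ym-idea-1, free
hands), `--supports stmt-QuantumFields-24141`.  References: [cite: Griffiths1964]; [cite: SeilerLNP1982, §2]; [cite: Luscher1983, §2].
-/

set_option autoImplicit false

noncomputable section

open MeasureTheory Set Filter Metric
open scoped Topology BigOperators
open Literature.MathematicalPhysics.QuantumFieldTheory hiding SU2
open Literature.MathematicalPhysics.QuantumLattice

namespace Summit.QuantumFields.YangMills.Theorems.VirialFluxGap.TreeGaugeTransfer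

open Summit.QuantumFields.YangMills.Theorems.FemtoTransferGap
open Summit.QuantumFields.YangMills.Theorems.FemtoTransferGap.TT
open Summit.QuantumFields.YangMills.Theorems.VirialFluxGap.RingDeficit
open Summit.QuantumFields.YangMills.Theorems.VirialFluxGap.HaarIBP
open Summit.QuantumFields.YangMills.Theorems.VirialFluxGap.RingIBP (measurableMul_prod)
open Summit.QuantumFields.YangMills.Theorems.VirialFluxGap.VolumeFloor (exp_le_ringMeasure_real_deficit_le)

variable {L : ℕ} [NeZero L]

/-! ## §1 The reduced product group: measurability, invariance, integrability -/

omit [NeZero L] in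
/-- The reduced space has measurable (pointwise) multiplication. [folklore] -/
theorem measurableMul_fixSpace :
    MeasurableMul ((OffIdx L → SU2) × ((Fin (2 * L - 1) → GaugeConfig 3 L SU2) × (Site 3 L → SU2))) := by
  haveI : MeasurableMul ((Fin (2 * L - 1) → GaugeConfig 3 L SU2) × (Site 3 L → SU2)) := measurableMul_prod
  exact measurableMul_prod

/-- The reduced measure (product Haar) is a probability measure. [folklore] -/
theorem isProbabilityMeasure_fixMeasure :
    IsProbabilityMeasure ((Measure.pi fun _ : OffIdx L => haarProbability SU2).prod
      ((Measure.pi fun _ : Fin (2 * L - 1) => configMeasure SU2 L).prod (gaugeMeasure L))) := by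
  haveI : IsProbabilityMeasure (gaugeMeasure L) := isProbabilityMeasure_gaugeMeasure (L := L)
  infer_instance

/-- ★ **The reduced measure is right invariant** (pointwise group structure). [folklore] -/
theorem isMulRightInvariant_fixMeasure :
    ((Measure.pi fun _ : OffIdx L => haarProbability SU2).prod
      ((Measure.pi fun _ : Fin (2 * L - 1) => configMeasure SU2 L).prod (gaugeMeasure L))).IsMulRightInvariant := by
  haveI : IsProbabilityMeasure (gaugeMeasure L) := isProbabilityMeasure_gaugeMeasure (L := L)
  haveI := isMulRightInvariant_gaugeMeasure (L := L)
  haveI : (configMeasure SU2 L).IsMulRightInvariant := RingIBP.isMulRightInvariant_configMeasure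
  haveI : (Measure.pi fun _ : Fin (2 * L - 1) => configMeasure SU2 L).IsMulRightInvariant := Measure.pi.isMulRightInvariant _
  haveI : (Measure.pi fun _ : OffIdx L => haarProbability SU2).IsMulRightInvariant := Measure.pi.isMulRightInvariant _
  haveI : MeasurableMul ((Fin (2 * L - 1) → GaugeConfig 3 L SU2) × (Site 3 L → SU2)) := measurableMul_prod
  haveI := measurableMul_fixSpace (L := L)
  haveI : ((Measure.pi fun _ : Fin (2 * L - 1) => configMeasure SU2 L).prod (gaugeMeasure L)).IsMulRightInvariant :=
    Measure.prod.instIsMulRightInvariant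
  exact Measure.prod.instIsMulRightInvariant

/-- The reduced deficit is measurable. [folklore] -/
theorem measurable_fixDeficit :
    Measurable fun x : (OffIdx L → SU2) × ((Fin (2 * L - 1) → GaugeConfig 3 L SU2) × (Site 3 L → SU2)) =>
      ringDeficit L (fun _ => false) ((Fin.cons (glue x.1) x.2.1 : Fin (2 * L - 1 + 1) → GaugeConfig 3 L SU2), x.2.2) :=
  measurable_comp_fix (measurable_ringDeficit _)

/-- Bounded strongly measurable functions are integrable against the reduced Gibbs weight (`β ≥ 0`). [folklore] -/
theorem integrable_mul_exp_of_bound_fix {β : ℝ} (hβ : 0 ≤ β)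
    {h : (OffIdx L → SU2) × ((Fin (2 * L - 1) → GaugeConfig 3 L SU2) × (Site 3 L → SU2)) → ℝ} {C : ℝ}
    (hm : StronglyMeasurable h) (hb : ∀ x, |h x| ≤ C) :
    Integrable (fun x => h x * Real.exp (-(β * ringDeficit L (fun _ => false)
        ((Fin.cons (glue x.1) x.2.1 : Fin (2 * L - 1 + 1) → GaugeConfig 3 L SU2), x.2.2))))
      ((Measure.pi fun _ : OffIdx L => haarProbability SU2).prod
        ((Measure.pi fun _ : Fin (2 * L - 1) => configMeasure SU2 L).prod (gaugeMeasure L))) := by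
  haveI := isProbabilityMeasure_fixMeasure (L := L)
  have hem := ((measurable_fixDeficit (L := L)).const_mul β).neg.exp
  refine (integrable_const C).mono' (hm.mul hem.stronglyMeasurable).aestronglyMeasurable (Eventually.of_forall fun x => ?_)
  have hexp_le : Real.exp (-(β * ringDeficit L (fun _ => false)
      ((Fin.cons (glue x.1) x.2.1 : Fin (2 * L - 1 + 1) → GaugeConfig 3 L SU2), x.2.2))) ≤ 1 := by
    rw [Real.exp_le_one_iff]
    have := mul_nonneg hβ (ringDeficit_nonneg (L := L) (fun _ => false)
      ((Fin.cons (glue x.1) x.2.1 : Fin (2 * L - 1 + 1) → GaugeConfig 3 L SU2), x.2.2))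
    linarith
  rw [Real.norm_eq_abs, abs_mul, abs_of_pos (Real.exp_pos _)]
  calc |h x| * Real.exp (-(β * ringDeficit L (fun _ => false)
        ((Fin.cons (glue x.1) x.2.1 : Fin (2 * L - 1 + 1) → GaugeConfig 3 L SU2), x.2.2))) ≤ C * 1 :=
        mul_le_mul (hb x) hexp_le (Real.exp_pos _).le ((abs_nonneg _).trans (hb x))
    _ = C := mul_one C

/-- `∫ e^{−βF_fix} dμ_fix > 0` (it equals `∫ e^{−βF₀} dμ_L`). [folklore] -/
theorem integral_exp_fix_pos {β : ℝ} (hβ : 0 ≤ β) :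
    0 < ∫ x, Real.exp (-(β * ringDeficit L (fun _ => false)
        ((Fin.cons (glue x.1) x.2.1 : Fin (2 * L - 1 + 1) → GaugeConfig 3 L SU2), x.2.2)))
      ∂((Measure.pi fun _ : OffIdx L => haarProbability SU2).prod
        ((Measure.pi fun _ : Fin (2 * L - 1) => configMeasure SU2 L).prod (gaugeMeasure L))) := by
  rw [← integral_exp_eq_fix hβ]; exact integral_exp_neg_mul_ringDeficit_pos β _

/-! ## §2 The Gibbs ∕ virial pairing and the mean bound on the reduced group -/

/-- ★★ **Virial mean inequality for the reduced deficit** (w3's ✓`ring_virial_gibbsMean_le` on `X_fix`). [cite: Griffiths1964] -/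
theorem fix_virial_gibbsMean_le {J : Type*} (s : Finset J)
    {γ : J → ℝ → (OffIdx L → SU2) × ((Fin (2 * L - 1) → GaugeConfig 3 L SU2) × (Site 3 L → SU2))} (hγ : ∀ j ∈ s, γ j 0 = 1)
    {φ : J → (OffIdx L → SU2) × ((Fin (2 * L - 1) → GaugeConfig 3 L SU2) × (Site 3 L → SU2)) → ℝ} (hφm : ∀ j ∈ s, Measurable (φ j))
    {Cφ : J → ℝ} (hφb : ∀ j ∈ s, ∀ x, |φ j x| ≤ Cφ j)
    {Dφ DF : J → ℝ → (OffIdx L → SU2) × ((Fin (2 * L - 1) → GaugeConfig 3 L SU2) × (Site 3 L → SU2)) → ℝ} {ε₀ : ℝ} (hε₀ : 0 < ε₀)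
    (hDφ : ∀ j ∈ s, ∀ x, ∀ t ∈ ball (0 : ℝ) ε₀, HasDerivAt (fun s' => φ j (x * γ j s')) (Dφ j t x) t)
    (hDF : ∀ j ∈ s, ∀ x, ∀ t ∈ ball (0 : ℝ) ε₀, HasDerivAt (fun s' => ringDeficit L (fun _ => false)
      ((Fin.cons (glue (x * γ j s').1) (x * γ j s').2.1 : Fin (2 * L - 1 + 1) → GaugeConfig 3 L SU2), (x * γ j s').2.2)) (DF j t x) t)
    {Bφ BF : J → ℝ} (hDφb : ∀ j ∈ s, ∀ x, ∀ t ∈ ball (0 : ℝ) ε₀, |Dφ j t x| ≤ Bφ j)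
    (hDFb : ∀ j ∈ s, ∀ x, ∀ t ∈ ball (0 : ℝ) ε₀, |DF j t x| ≤ BF j)
    (hDφm : ∀ j ∈ s, StronglyMeasurable (Dφ j 0)) (hDFm : ∀ j ∈ s, StronglyMeasurable (DF j 0)) {β : ℝ} (hβ : 0 ≤ β)
    {E : (OffIdx L → SU2) × ((Fin (2 * L - 1) → GaugeConfig 3 L SU2) × (Site 3 L → SU2)) → ℝ} (hEm : Measurable E) {CE : ℝ}
    (hEb : ∀ x, |E x| ≤ CE) {D ε : ℝ} (hε : ε < 1)
    (hXF : ∀ x, 2 * (1 - ε) * ringDeficit L (fun _ => false)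
        ((Fin.cons (glue x.1) x.2.1 : Fin (2 * L - 1 + 1) → GaugeConfig 3 L SU2), x.2.2) - E x ≤ ∑ j ∈ s, φ j x * DF j 0 x)
    (hdiv : ∀ x, ∑ j ∈ s, Dφ j 0 x ≤ D) :
    β * (∫ x, ringDeficit L (fun _ => false) ((Fin.cons (glue x.1) x.2.1 : Fin (2 * L - 1 + 1) → GaugeConfig 3 L SU2), x.2.2) *
          Real.exp (-(β * ringDeficit L (fun _ => false)
            ((Fin.cons (glue x.1) x.2.1 : Fin (2 * L - 1 + 1) → GaugeConfig 3 L SU2), x.2.2)))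
        ∂((Measure.pi fun _ : OffIdx L => haarProbability SU2).prod
          ((Measure.pi fun _ : Fin (2 * L - 1) => configMeasure SU2 L).prod (gaugeMeasure L)))) /
        (∫ x, Real.exp (-(β * ringDeficit L (fun _ => false)
            ((Fin.cons (glue x.1) x.2.1 : Fin (2 * L - 1 + 1) → GaugeConfig 3 L SU2), x.2.2)))
          ∂((Measure.pi fun _ : OffIdx L => haarProbability SU2).prod
            ((Measure.pi fun _ : Fin (2 * L - 1) => configMeasure SU2 L).prod (gaugeMeasure L)))) ≤
      (D + β * (∫ x, E x * Real.exp (-(β * ringDeficit L (fun _ => false)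
            ((Fin.cons (glue x.1) x.2.1 : Fin (2 * L - 1 + 1) → GaugeConfig 3 L SU2), x.2.2)))
          ∂((Measure.pi fun _ : OffIdx L => haarProbability SU2).prod
            ((Measure.pi fun _ : Fin (2 * L - 1) => configMeasure SU2 L).prod (gaugeMeasure L)))) /
        (∫ x, Real.exp (-(β * ringDeficit L (fun _ => false)
            ((Fin.cons (glue x.1) x.2.1 : Fin (2 * L - 1 + 1) → GaugeConfig 3 L SU2), x.2.2)))
          ∂((Measure.pi fun _ : OffIdx L => haarProbability SU2).prod
            ((Measure.pi fun _ : Fin (2 * L - 1) => configMeasure SU2 L).prod (gaugeMeasure L))))) / (2 * (1 - ε)) := by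
  haveI := isProbabilityMeasure_fixMeasure (L := L)
  haveI := isMulRightInvariant_fixMeasure (L := L)
  haveI := measurableMul_fixSpace (L := L)
  set μ := (Measure.pi fun _ : OffIdx L => haarProbability SU2).prod
    ((Measure.pi fun _ : Fin (2 * L - 1) => configMeasure SU2 L).prod (gaugeMeasure L)) with hμ
  set F : (OffIdx L → SU2) × ((Fin (2 * L - 1) → GaugeConfig 3 L SU2) × (Site 3 L → SU2)) → ℝ := fun x =>
    ringDeficit L (fun _ => false) ((Fin.cons (glue x.1) x.2.1 : Fin (2 * L - 1 + 1) → GaugeConfig 3 L SU2), x.2.2) with hF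
  have hFm : Measurable F := measurable_fixDeficit
  have hF0 : ∀ x, 0 ≤ F x := fun x => ringDeficit_nonneg _ _
  have hpair := sum_integral_deriv_mul_exp_eq_of_mulRight μ s hγ hφm hFm hφb hF0 hε₀ hDφ hDF hDφb hDFb hDφm hDFm hβ
  -- integrability bookkeeping
  obtain ⟨B, hB⟩ := exists_abs_ringDeficit_le (L := L) (fun _ => false)
  have hgm : StronglyMeasurable fun x => ∑ j ∈ s, φ j x * DF j 0 x := by
    have h : ∀ j ∈ s, StronglyMeasurable (fun x => φ j x * DF j 0 x) := fun j hj => (hφm j hj).stronglyMeasurable.mul (hDFm j hj)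
    have heq : (fun x => ∑ j ∈ s, φ j x * DF j 0 x) = ∑ j ∈ s, (fun x => φ j x * DF j 0 x) := by
      funext x; simp only [Finset.sum_apply]
    rw [heq]
    exact Finset.stronglyMeasurable_sum s h
  have hgb : ∀ x, |∑ j ∈ s, φ j x * DF j 0 x| ≤ ∑ j ∈ s, Cφ j * BF j := fun x => by
    refine (Finset.abs_sum_le_sum_abs _ _).trans (Finset.sum_le_sum fun j hj => ?_)
    rw [abs_mul]
    exact mul_le_mul (hφb j hj x) (hDFb j hj x 0 (mem_ball_self hε₀)) (abs_nonneg _) ((abs_nonneg _).trans (hφb j hj x))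
  have hdm : StronglyMeasurable fun x => ∑ j ∈ s, Dφ j 0 x := by
    have heq : (fun x => ∑ j ∈ s, Dφ j 0 x) = ∑ j ∈ s, Dφ j 0 := by
      funext x; simp only [Finset.sum_apply]
    rw [heq]
    exact Finset.stronglyMeasurable_sum s fun j hj => hDφm j hj
  have hdb : ∀ x, |∑ j ∈ s, Dφ j 0 x| ≤ ∑ j ∈ s, Bφ j := fun x =>
    (Finset.abs_sum_le_sum_abs _ _).trans (Finset.sum_le_sum fun j hj => hDφb j hj x 0 (mem_ball_self hε₀))
  have hFb : ∀ x, |F x| ≤ B := fun x => hB _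
  have h1b : ∀ x : (OffIdx L → SU2) × ((Fin (2 * L - 1) → GaugeConfig 3 L SU2) × (Site 3 L → SU2)), |(1 : ℝ)| ≤ 1 := fun _ => by
    rw [abs_one]
  have hZi : Integrable (fun x => Real.exp (-(β * F x))) μ := by
    have h := integrable_mul_exp_of_bound_fix (L := L) hβ stronglyMeasurable_const h1b
    exact h.congr (Eventually.of_forall fun x => by simp only [one_mul]; rfl)
  exact virial_gibbsMean_le μ hβ hε hpair hXF hdiv (integrable_mul_exp_of_bound_fix hβ hFm.stronglyMeasurable hFb)
    (integrable_mul_exp_of_bound_fix hβ hEm.stronglyMeasurable hEb) (integrable_mul_exp_of_bound_fix hβ hgm hgb)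
    (integrable_mul_exp_of_bound_fix hβ hdm hdb) hZi (integral_exp_fix_pos hβ)

/-- ★★ **Gibbs mean of a supported error term against the TRANSFERRED floor** on `X_fix`: for `E ≤ E_max` vanishing on `{F_fix < t₁}`,
`0 < t₁ ≤ 2`, `β ≥ 0`: `⟨E⟩_β ≤ E_max · exp(−βt₁/2 + 150·L⁵·(1 + log(2/t₁)))`. [cite: Luscher1983, §2] -/
theorem fix_gibbsMean_error_le {E : (OffIdx L → SU2) × ((Fin (2 * L - 1) → GaugeConfig 3 L SU2) × (Site 3 L → SU2)) → ℝ}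
    {β t₁ Emax : ℝ} (hβ : 0 ≤ β) (ht₁ : 0 < t₁) (ht₁2 : t₁ ≤ 2) (hEmax : 0 ≤ Emax)
    (hEle : ∀ x, E x ≤ Emax) (hEsupp : ∀ x, ringDeficit L (fun _ => false)
      ((Fin.cons (glue x.1) x.2.1 : Fin (2 * L - 1 + 1) → GaugeConfig 3 L SU2), x.2.2) < t₁ → E x = 0) :
    (∫ x, E x * Real.exp (-(β * ringDeficit L (fun _ => false)
          ((Fin.cons (glue x.1) x.2.1 : Fin (2 * L - 1 + 1) → GaugeConfig 3 L SU2), x.2.2)))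
        ∂((Measure.pi fun _ : OffIdx L => haarProbability SU2).prod
          ((Measure.pi fun _ : Fin (2 * L - 1) => configMeasure SU2 L).prod (gaugeMeasure L)))) /
        (∫ x, Real.exp (-(β * ringDeficit L (fun _ => false)
            ((Fin.cons (glue x.1) x.2.1 : Fin (2 * L - 1 + 1) → GaugeConfig 3 L SU2), x.2.2)))
          ∂((Measure.pi fun _ : OffIdx L => haarProbability SU2).prod
            ((Measure.pi fun _ : Fin (2 * L - 1) => configMeasure SU2 L).prod (gaugeMeasure L)))) ≤
      Emax * Real.exp (-(β * t₁ / 2) + 150 * (L : ℝ) ^ 5 * (1 + Real.log (2 / t₁))) := by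
  haveI := isProbabilityMeasure_fixMeasure (L := L)
  set μ := (Measure.pi fun _ : OffIdx L => haarProbability SU2).prod
    ((Measure.pi fun _ : Fin (2 * L - 1) => configMeasure SU2 L).prod (gaugeMeasure L)) with hμ
  have hs0 : 0 < t₁ / 2 := by linarith
  have hs1 : t₁ / 2 ≤ 1 := by linarith
  have hfloorΩ := exp_le_ringMeasure_real_deficit_le (L := L) hs0 hs1
  have hfloor : Real.exp (-(150 * (L : ℝ) ^ 5 * (1 + Real.log (t₁ / 2)⁻¹))) ≤
      μ.real {x | ringDeficit L (fun _ => false)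
        ((Fin.cons (glue x.1) x.2.1 : Fin (2 * L - 1 + 1) → GaugeConfig 3 L SU2), x.2.2) ≤ t₁ / 2} := by
    rw [hμ, ← measureReal_deficit_le_eq_fix (L := L) (t₁ / 2)]; exact hfloorΩ
  have hpos : 0 < μ.real {x | ringDeficit L (fun _ => false)
      ((Fin.cons (glue x.1) x.2.1 : Fin (2 * L - 1 + 1) → GaugeConfig 3 L SU2), x.2.2) ≤ t₁ / 2} := (Real.exp_pos _).trans_le hfloor
  have h := gibbsMean_error_le μ (measurable_fixDeficit (L := L)) hβ hEmax hEle hEsupp (fun x => ringDeficit_nonneg _ _)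
    (s := t₁ / 2) hpos
  have hinv : Real.log (2 / t₁) = Real.log (t₁ / 2)⁻¹ := by rw [inv_div]
  have hm : Real.exp (-(150 * (L : ℝ) ^ 5 * (1 + Real.log (2 / t₁)))) ≤
      μ.real {x | ringDeficit L (fun _ => false)
        ((Fin.cons (glue x.1) x.2.1 : Fin (2 * L - 1 + 1) → GaugeConfig 3 L SU2), x.2.2) ≤ t₁ / 2} := by rw [hinv]; exact hfloor
  calc (∫ x, E x * Real.exp (-(β * ringDeficit L (fun _ => false)
          ((Fin.cons (glue x.1) x.2.1 : Fin (2 * L - 1 + 1) → GaugeConfig 3 L SU2), x.2.2))) ∂μ) /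
        (∫ x, Real.exp (-(β * ringDeficit L (fun _ => false)
          ((Fin.cons (glue x.1) x.2.1 : Fin (2 * L - 1 + 1) → GaugeConfig 3 L SU2), x.2.2))) ∂μ)
      ≤ Emax * Real.exp (-(β * (t₁ - t₁ / 2))) * μ.real univ /
          μ.real {x | ringDeficit L (fun _ => false)
            ((Fin.cons (glue x.1) x.2.1 : Fin (2 * L - 1 + 1) → GaugeConfig 3 L SU2), x.2.2) ≤ t₁ / 2} := h
    _ = Emax * Real.exp (-(β * t₁ / 2)) /
          μ.real {x | ringDeficit L (fun _ => false)
            ((Fin.cons (glue x.1) x.2.1 : Fin (2 * L - 1 + 1) → GaugeConfig 3 L SU2), x.2.2) ≤ t₁ / 2} := by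
        rw [probReal_univ, mul_one, show -(β * (t₁ - t₁ / 2)) = -(β * t₁ / 2) by ring]
    _ ≤ Emax * Real.exp (-(β * t₁ / 2)) / Real.exp (-(150 * (L : ℝ) ^ 5 * (1 + Real.log (2 / t₁)))) :=
        div_le_div_of_nonneg_left (by positivity) (Real.exp_pos _) hm
    _ = Emax * Real.exp (-(β * t₁ / 2) + 150 * (L : ℝ) ^ 5 * (1 + Real.log (2 / t₁))) := by
        rw [Real.exp_add, div_eq_mul_inv, ← Real.exp_neg, neg_neg, mul_assoc]

end Summit.QuantumFields.YangMills.Theorems.VirialFluxGap.TreeGaugeTransfer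

end
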